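import Mathlib
import Literature.Analysis.Calculus.WhitneyEvenFunction
import Summits.AtomisticToContinuum.HydrodynamicLimit.Theorems.ImplosionDichotomyDenseExcursionPackingAnalyticDefsB

/-!
# Centre-regular pairs as RADIAL SMOOTH FUNCTIONS: the algebra behind the sources of the hierarchy of `Γ`
# (crux `DenseExcursion`, stmt-AtomisticToContinuum-12586, line `sonic-cavity-renewal` v7, stub `stub_analyticPackingImplosion`)

Helper file (`--supports stmt-AtomisticToContinuum-12586`, line lead a2, wave-3 worker D, task `packingSources_regular`).
The hierarchy `(kμ − L) X_k = Src_k` of the analytic packing implosion (`packingHierarchy_order`) has sources that are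
POLYNOMIALS in the lower orders `X_j = (wc j, sc j)`, `j < k`, their first `x`-derivatives, `e^{3x}` and the jet of the
stiffening law. To feed them to the resolvent (`PackingResolvent`) one must know that they are again CENTRE-REGULAR
pairs (`IsRegularPair` of `…R2Modes`: the radial fields `y ↦ w(log ‖y‖) y` and `y ↦ ‖y‖ s(log ‖y‖)` extend to `C^∞`
fields on `ℝ³`). Kernel-checked here, the structural fact that makes this an ALGEBRA question:

* `isRegularPair_iff_radial` (REGISTERED helper): a REAL pair `(u₁, u₂)` is a regular pair iff
  `y ↦ u₁(log ‖y‖)` and `y ↦ ‖y‖ u₂(log ‖y‖)` extend to smooth SCALAR fields on `ℝ³` — the direction `⇒` is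
  Hadamard's lemma along the ray (`t u₁(log |t|) = ⟨F(t e₀), e₀⟩` is smooth and odd, so its quotient by `t` is smooth
  and even) followed by WHITNEY'S THEOREM ON EVEN FUNCTIONS (`Literature.Analysis.Calculus.contDiff_comp_norm_of_even`:
  a smooth even function of `‖y‖` is smooth on `ℝ³`);
* `contDiff_radial_of_even`, `exists_even_quotient` (the two tools), `radialExt_deriv` (the class of `f` with
  `y ↦ f(log ‖y‖)` smooth is stable under `d/dx`: `f′(log ‖y‖) = DΦ(y)·y`), `radialExt_div` (THE DIVISION LEMMA:
  for such `f`, also `y ↦ e^{−2x} f′(x)|_{x = log ‖y‖} = f′(log ‖y‖)/‖y‖²` is smooth — the derivative of a smooth even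
  function of `ρ = ‖y‖` is `ρ ×` smooth even; this is what makes the pressure terms `3 sc i (sc j′ + sc j)` of `Src_w`
  regular although `sc i · sc j ∼ e^{−2x}` is not), `contDiff_of_radialExt` (such `f` are smooth in `x`).

Sources: H. Whitney, Duke Math. J. 10 (1943) Thm. 1 (via the Literature file); J. Dieudonné, Foundations (8.11.2).
NOT here: the sources themselves (next file), norms, or `Γ`.
-/

noncomputable section

open Set Filter
open scoped Topology ContDiff

namespace Summit.AtomisticToContinuum.HydrodynamicLimit.Theorems.PackingAnalyticImplosion

open Literature.MathematicalPhysics.KineticTheory (V3)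
open Summit.AtomisticToContinuum.HydrodynamicLimit.Theorems.KidderKnobMelnikov (norm_smul_unitVec
  smul_unitVec_apply_zero)
open Summit.AtomisticToContinuum.HydrodynamicLimit.Theorems.R2OneModeTwoConditions

/-! ## The two tools: Whitney's even-function theorem on `ℝ³` and Hadamard's quotient in one variable -/

/-- **A smooth even function of the norm is smooth on `ℝ³`** (Whitney's theorem, through
`Literature.Analysis.Calculus.contDiff_comp_norm_of_even` with a trivial parameter). [folklore] -/
theorem contDiff_radial_of_even {φ : ℝ → ℝ} (hφ : ContDiff ℝ ∞ φ) (heven : ∀ t, φ (-t) = φ t) :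
    ContDiff ℝ ∞ (fun y : V3 => φ ‖y‖) := by
  have hF : ContDiff ℝ ∞ (fun p : ℝ × ℝ => φ p.1) := hφ.comp contDiff_fst
  have h := Literature.Analysis.Calculus.contDiff_comp_norm_of_even (P := ℝ) (E := ℝ) (F := fun p : ℝ × ℝ => φ p.1)
    hF (fun ρ _ => heven ρ) (ContinuousLinearMap.id ℝ V3) (z := fun _ : V3 => (0 : ℝ)) contDiff_const
  simpa using h

/-- **Hadamard's quotient of a smooth odd function**: a smooth odd `g : ℝ → ℝ` is `t · q(t)` with `q` smooth and
EVEN (`q(t) = ∫₀¹ g′(st) ds`). [folklore] -/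
theorem exists_even_quotient {g : ℝ → ℝ} (hg : ContDiff ℝ ∞ g) (hodd : ∀ t, g (-t) = -g t) :
    ∃ q : ℝ → ℝ, ContDiff ℝ ∞ q ∧ (∀ t, q (-t) = q t) ∧ ∀ t, t * q t = g t := by
  set G : ℝ × ℝ → ℝ := fun p => g p.1 with hGdef
  have hG : ContDiff ℝ ∞ G := hg.comp contDiff_fst
  have hGodd : ∀ ρ (z : ℝ), G (-ρ, z) = -G (ρ, z) := fun ρ _ => hodd ρ
  have hG0 : G (0, 0) = 0 := Literature.Analysis.Calculus.eq_zero_of_odd hGodd 0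
  refine ⟨fun t => ∫ s in (0 : ℝ)..1, fderiv ℝ G (s * t, 0) ((1 : ℝ), (0 : ℝ)), ?_, ?_, ?_⟩
  · have h := Literature.Analysis.Calculus.contDiff_integral_fderiv_fst (P := ℝ) (E := ℝ) hG
    exact h.comp (contDiff_id.prodMk contDiff_const)
  · intro t
    exact Literature.Analysis.Calculus.integral_fderiv_fst_even
      (Literature.Analysis.Calculus.fderiv_fst_eq_of_odd (hG.differentiable (by simp)) hGodd) t 0
  · intro t
    have h := Literature.Analysis.Calculus.smul_integral_fderiv_fst_eq_sub (P := ℝ) (E := ℝ)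
      (hG.of_le (by exact_mod_cast le_top)) t 0
    rw [smul_eq_mul, hG0, sub_zero] at h
    exact h

/-! ## Radial extensions: smoothness in `x`, derivative, division -/

/-- If `y ↦ f(log ‖y‖)` extends to a smooth scalar field `Φ`, then `f` is smooth (`f x = Φ(eˣ e₀)`). [folklore] -/
theorem contDiff_of_radialExt {f : ℝ → ℝ} {Φ : V3 → ℝ} (hΦ : ContDiff ℝ ∞ Φ)
    (hΦf : ∀ y : V3, y ≠ 0 → Φ y = f (Real.log ‖y‖)) : ContDiff ℝ ∞ f := by
  have h : ContDiff ℝ ∞ (fun x : ℝ => Φ (Real.exp x • (EuclideanSpace.single 0 1 : V3))) :=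
    hΦ.comp (Real.contDiff_exp.smul contDiff_const)
  have e : f = fun x : ℝ => Φ (Real.exp x • (EuclideanSpace.single 0 1 : V3)) := by
    funext x
    have hne : Real.exp x • (EuclideanSpace.single 0 1 : V3) ≠ 0 :=
      norm_pos_iff.1 (by rw [norm_smul_unitVec (Real.exp_pos x).le]; exact Real.exp_pos x)
    rw [hΦf _ hne, norm_smul_unitVec (Real.exp_pos x).le, Real.log_exp]
  rw [e]
  exact h

/-- If `y ↦ ‖y‖ g(log ‖y‖)` extends to a smooth scalar field `Ψ`, then `g` is smooth (`g x = e^{−x} Ψ(eˣ e₀)`).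
[folklore] -/
theorem contDiff_of_radialExt_weighted {g : ℝ → ℝ} {Ψ : V3 → ℝ} (hΨ : ContDiff ℝ ∞ Ψ)
    (hΨg : ∀ y : V3, y ≠ 0 → Ψ y = ‖y‖ * g (Real.log ‖y‖)) : ContDiff ℝ ∞ g := by
  have h : ContDiff ℝ ∞ (fun x : ℝ => Real.exp (-x) * Ψ (Real.exp x • (EuclideanSpace.single 0 1 : V3))) :=
    (Real.contDiff_exp.comp contDiff_neg).mul (hΨ.comp (Real.contDiff_exp.smul contDiff_const))
  have e : g = fun x : ℝ => Real.exp (-x) * Ψ (Real.exp x • (EuclideanSpace.single 0 1 : V3)) := by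
    funext x
    have hne : Real.exp x • (EuclideanSpace.single 0 1 : V3) ≠ 0 :=
      norm_pos_iff.1 (by rw [norm_smul_unitVec (Real.exp_pos x).le]; exact Real.exp_pos x)
    rw [hΨg _ hne, norm_smul_unitVec (Real.exp_pos x).le, Real.log_exp, ← mul_assoc, ← Real.exp_add]
    simp
  rw [e]
  exact h

/-- **The class is stable under `d/dx`**: if `y ↦ f(log ‖y‖)` extends to a smooth `Φ`, then `y ↦ f′(log ‖y‖)`
extends to the smooth field `y ↦ DΦ(y)·y` (Euler's identity along rays). [folklore] -/
theorem radialExt_deriv {f : ℝ → ℝ} {Φ : V3 → ℝ} (hΦ : ContDiff ℝ ∞ Φ)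
    (hΦf : ∀ y : V3, y ≠ 0 → Φ y = f (Real.log ‖y‖)) :
    ContDiff ℝ ∞ (fun y : V3 => fderiv ℝ Φ y y) ∧ ∀ y : V3, y ≠ 0 → fderiv ℝ Φ y y = deriv f (Real.log ‖y‖) := by
  have hf : ContDiff ℝ ∞ f := contDiff_of_radialExt hΦ hΦf
  have hfd : Differentiable ℝ f := hf.differentiable (by simp)
  refine ⟨(hΦ.fderiv_right (m := ∞) (by simp)).clm_apply contDiff_id, fun y hy => ?_⟩
  have hy' : 0 < ‖y‖ := norm_pos_iff.2 hy
  have hΦd : Differentiable ℝ Φ := hΦ.differentiable (by simp)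
  have h1 : HasDerivAt (fun t : ℝ => Φ (t • y)) (fderiv ℝ Φ y y) 1 := by
    have h := (hΦd y).hasFDerivAt.comp_hasDerivAt_of_eq (1 : ℝ) ((hasDerivAt_id' (1 : ℝ)).smul_const y)
      (one_smul ℝ y).symm
    rw [one_smul] at h
    exact h
  have h2 : HasDerivAt (fun t : ℝ => f (Real.log t + Real.log ‖y‖)) (deriv f (Real.log ‖y‖)) 1 := by
    have hl : HasDerivAt (fun t : ℝ => Real.log t + Real.log ‖y‖) (1 : ℝ)⁻¹ 1 :=
      (Real.hasDerivAt_log one_ne_zero).add_const _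
    have h : HasDerivAt (fun t : ℝ => f (Real.log t + Real.log ‖y‖))
        (deriv f (Real.log 1 + Real.log ‖y‖) * (1 : ℝ)⁻¹) 1 := (hfd _).hasDerivAt.comp (1 : ℝ) hl
    simpa [Real.log_one] using h
  have heq : (fun t : ℝ => Φ (t • y)) =ᶠ[𝓝 1] fun t => f (Real.log t + Real.log ‖y‖) := by
    filter_upwards [Ioi_mem_nhds one_pos] with t ht
    have ht : 0 < t := ht
    rw [hΦf (t • y) (smul_ne_zero ht.ne' hy), norm_smul, Real.norm_of_nonneg ht.le, Real.log_mul ht.ne' hy'.ne']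
  exact h1.unique (h2.congr_of_eventuallyEq heq)

/-- **THE DIVISION LEMMA.** If `y ↦ f(log ‖y‖)` extends to a smooth `Φ`, then `y ↦ f′(log ‖y‖)/‖y‖²`, i.e.
`e^{−2x} f′(x)` read at `x = log ‖y‖`, ALSO extends to a smooth scalar field: `φ(ρ) = Φ(ρ e₀)` is smooth and even, so
`φ′` is smooth and odd, `φ′(ρ) = ρ q(ρ)` with `q` smooth even (Hadamard), `q(‖y‖)` is smooth (Whitney), and
`q(ρ) = f′(log ρ)/ρ²` for `ρ > 0`. [folklore] -/
theorem radialExt_div {f : ℝ → ℝ} {Φ : V3 → ℝ} (hΦ : ContDiff ℝ ∞ Φ)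
    (hΦf : ∀ y : V3, y ≠ 0 → Φ y = f (Real.log ‖y‖)) :
    ∃ Ψ : V3 → ℝ, ContDiff ℝ ∞ Ψ ∧
      ∀ y : V3, y ≠ 0 → Ψ y = Real.exp (-2 * Real.log ‖y‖) * deriv f (Real.log ‖y‖) := by
  have hf : ContDiff ℝ ∞ f := contDiff_of_radialExt hΦ hΦf
  have hfd : Differentiable ℝ f := hf.differentiable (by simp)
  set e₀ : V3 := EuclideanSpace.single 0 1 with he₀
  -- the even profile `φ(ρ) = Φ(ρ e₀)` and its odd derivative
  set φ : ℝ → ℝ := fun ρ => Φ (ρ • e₀) with hφdef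
  have hφ : ContDiff ℝ ∞ φ := hΦ.comp (contDiff_id.smul contDiff_const)
  have hnorm : ∀ ρ : ℝ, ‖ρ • e₀‖ = |ρ| := fun ρ => by
    rw [norm_smul, he₀, PiLp.norm_single, norm_one, mul_one, Real.norm_eq_abs]
  have hφf : ∀ ρ : ℝ, ρ ≠ 0 → φ ρ = f (Real.log |ρ|) := by
    intro ρ hρ
    have hne : ρ • e₀ ≠ 0 := norm_pos_iff.1 (by rw [hnorm]; exact abs_pos.2 hρ)
    show Φ (ρ • e₀) = _
    rw [hΦf _ hne, hnorm]
  have hφeven : ∀ ρ, φ (-ρ) = φ ρ := by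
    intro ρ
    rcases eq_or_ne ρ 0 with rfl | hρ
    · rw [neg_zero]
    · rw [hφf ρ hρ, hφf (-ρ) (neg_ne_zero.2 hρ), abs_neg]
  have hφd : Differentiable ℝ φ := hφ.differentiable (by simp)
  have hdφ : ContDiff ℝ ∞ (deriv φ) := (contDiff_infty_iff_deriv.1 hφ).2
  have hdφodd : ∀ ρ, deriv φ (-ρ) = -deriv φ ρ := by
    intro ρ
    have h1 : deriv (fun t => φ (-t)) ρ = -deriv φ (-ρ) := deriv_comp_neg φ ρ
    have h2 : (fun t => φ (-t)) = φ := funext hφeven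
    rw [h2] at h1
    have h3 := h1  -- deriv φ ρ = -deriv φ (-ρ)
    have h4 : deriv φ (-ρ) = -deriv φ (- -ρ) := by
      have := deriv_comp_neg φ (-ρ)
      rw [h2] at this
      exact this
    rw [neg_neg] at h4
    exact h4
  -- Hadamard quotient of `φ′`
  obtain ⟨q, hq, hqeven, hqφ⟩ := exists_even_quotient hdφ hdφodd
  refine ⟨fun y => q ‖y‖, contDiff_radial_of_even hq hqeven, fun y hy => ?_⟩
  show q ‖y‖ = _
  have hρ : 0 < ‖y‖ := norm_pos_iff.2 hy
  set ρ : ℝ := ‖y‖ with hρdef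
  -- `φ′(ρ) = f′(log ρ)/ρ` for `ρ > 0`
  have hderiv : deriv φ ρ = deriv f (Real.log ρ) * ρ⁻¹ := by
    have h2 : HasDerivAt (fun t : ℝ => f (Real.log t)) (deriv f (Real.log ρ) * ρ⁻¹) ρ :=
      (hfd _).hasDerivAt.comp ρ (Real.hasDerivAt_log hρ.ne')
    have heq : (fun t : ℝ => f (Real.log t)) =ᶠ[𝓝 ρ] φ := by
      filter_upwards [Ioi_mem_nhds hρ] with t ht
      have ht : 0 < t := ht
      rw [hφf t ht.ne', abs_of_pos ht]
    exact (h2.congr_of_eventuallyEq heq.symm).deriv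
  have hmain := hqφ ρ
  rw [hderiv] at hmain
  -- solve `ρ q(ρ) = f′(log ρ) ρ⁻¹`
  have hq' : q ρ = deriv f (Real.log ρ) * ρ⁻¹ * ρ⁻¹ := by
    field_simp at hmain ⊢
    linarith
  have hexp : Real.exp (-2 * Real.log ρ) = (ρ ^ 2)⁻¹ := by
    rw [mul_comm (-2 : ℝ) _, Real.exp_mul, Real.exp_log hρ, Real.rpow_neg hρ.le,
      show (2 : ℝ) = ((2 : ℕ) : ℝ) by norm_num, Real.rpow_natCast]
  rw [hq', hexp]
  field_simp

/-! ## Regular pairs = pairs of radial smooth functions -/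

/-- From a smooth odd-type radial VECTOR field `F(y) = f(log ‖y‖) y` to the smooth SCALAR field `f(log ‖y‖)`:
Hadamard along the ray `t ↦ ⟨F(t e₀), e₀⟩ = t f(log |t|)` (smooth, odd), then Whitney. [folklore] -/
theorem radialExt_of_field {f : ℝ → ℝ} {F : V3 → V3} (hF : ContDiff ℝ ∞ F)
    (hfF : ∀ y : V3, y ≠ 0 → f (Real.log ‖y‖) • y = F y) :
    ∃ Φ : V3 → ℝ, ContDiff ℝ ∞ Φ ∧ ∀ y : V3, y ≠ 0 → Φ y = f (Real.log ‖y‖) := by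
  set e₀ : V3 := EuclideanSpace.single 0 1 with he₀
  have hnorm : ∀ ρ : ℝ, ‖ρ • e₀‖ = |ρ| := fun ρ => by
    rw [norm_smul, he₀, PiLp.norm_single, norm_one, mul_one, Real.norm_eq_abs]
  -- the ray function `g(t) = (F (t e₀)) 0 = t f(log |t|)`
  set g : ℝ → ℝ := fun t => (F (t • e₀)) 0 with hgdef
  have hg : ContDiff ℝ ∞ g :=
    (EuclideanSpace.proj (0 : Fin 3)).contDiff.comp (hF.comp (contDiff_id.smul contDiff_const))
  have hgf : ∀ t : ℝ, t ≠ 0 → g t = t * f (Real.log |t|) := by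
    intro t ht
    have hne : t • e₀ ≠ 0 := norm_pos_iff.1 (by rw [hnorm]; exact abs_pos.2 ht)
    show (F (t • e₀)) 0 = _
    rw [← hfF _ hne, hnorm, smul_smul, he₀, smul_unitVec_apply_zero, mul_comm]
  -- `g` is odd (off `0` by the formula, at `0` by continuity)
  have hgodd : ∀ t, g (-t) = -g t := by
    have hcont : Continuous g := hg.continuous
    have hk : (fun t => g (-t) + g t) = fun _ => (0 : ℝ) := by
      refine Continuous.ext_on (dense_compl_singleton (0 : ℝ)) ((hcont.comp continuous_neg).add hcont)
        continuous_const fun t ht => ?_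
      have ht : t ≠ 0 := ht
      show g (-t) + g t = 0
      rw [hgf t ht, hgf (-t) (neg_ne_zero.2 ht), abs_neg]
      ring
    intro t
    have h0 : g (-t) + g t = 0 := by simpa using congrFun hk t
    linarith
  obtain ⟨q, hq, hqeven, hqg⟩ := exists_even_quotient hg hgodd
  refine ⟨fun y => q ‖y‖, contDiff_radial_of_even hq hqeven, fun y hy => ?_⟩
  have hρ : 0 < ‖y‖ := norm_pos_iff.2 hy
  have h := hqg ‖y‖
  rw [hgf ‖y‖ hρ.ne', abs_of_pos hρ] at h
  simp only
  exact mul_left_cancel₀ hρ.ne' h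

/-- **REGULAR PAIRS ARE PAIRS OF RADIAL SMOOTH FUNCTIONS** (registered helper `isRegularPair_iff_radial` of
`stub_analyticPackingImplosion`): a real pair `(u₁, u₂)` (coerced to `ℂ` as in `PackingResolvent`) is centre-regular
iff `y ↦ u₁(log ‖y‖)` and `y ↦ ‖y‖ u₂(log ‖y‖)` extend to smooth scalar fields on `ℝ³`. With this, regularity of the
sources of the hierarchy is closure of a function ALGEBRA under products, `d/dx` (`radialExt_deriv`) and the
division lemma (`radialExt_div`). [folklore] -/
theorem isRegularPair_iff_radial : ∀ (u₁ u₂ : ℝ → ℝ), IsRegularPair (fun x => (u₁ x : ℂ)) (fun x => (u₂ x : ℂ)) ↔ (∃ Φ : V3 → ℝ, ContDiff ℝ ∞ Φ ∧ ∀ y : V3, y ≠ 0 → Φ y = u₁ (Real.log ‖y‖)) ∧ (∃ Ψ : V3 → ℝ, ContDiff ℝ ∞ Ψ ∧ ∀ y : V3, y ≠ 0 → Ψ y = ‖y‖ * u₂ (Real.log ‖y‖)) := by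
  intro u₁ u₂
  constructor
  · rintro ⟨-, -, F₁, F₂, G₁, G₂, hF₁, -, hG₁, -, hFG⟩
    refine ⟨radialExt_of_field hF₁ fun y hy => ?_, G₁, hG₁, fun y hy => ?_⟩
    · have h := (hFG y hy).1
      rwa [Complex.ofReal_re] at h
    · have h := (hFG y hy).2.2.1
      rw [Complex.ofReal_re] at h
      exact h.symm
  · rintro ⟨⟨Φ, hΦ, hΦu⟩, ⟨Ψ, hΨ, hΨu⟩⟩
    have hu₁ : ContDiff ℝ ∞ u₁ := contDiff_of_radialExt hΦ hΦu
    have hu₂ : ContDiff ℝ ∞ u₂ := contDiff_of_radialExt_weighted hΨ hΨu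
    refine ⟨Complex.ofRealCLM.contDiff.comp hu₁, Complex.ofRealCLM.contDiff.comp hu₂, fun y => Φ y • y, fun _ => 0,
      Ψ, fun _ => 0, hΦ.smul contDiff_id, contDiff_const, hΨ, contDiff_const, fun y hy => ?_⟩
    refine ⟨?_, ?_, ?_, ?_⟩
    · show ((u₁ (Real.log ‖y‖) : ℂ)).re • y = Φ y • y
      rw [Complex.ofReal_re, hΦu y hy]
    · show ((u₁ (Real.log ‖y‖) : ℂ)).im • y = 0
      rw [Complex.ofReal_im, zero_smul]
    · show ‖y‖ * ((u₂ (Real.log ‖y‖) : ℂ)).re = Ψ y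
      rw [Complex.ofReal_re, hΨu y hy]
    · show ‖y‖ * ((u₂ (Real.log ‖y‖) : ℂ)).im = 0
      rw [Complex.ofReal_im, mul_zero]

end Summit.AtomisticToContinuum.HydrodynamicLimit.Theorems.PackingAnalyticImplosion

end
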